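import Summits.BirchSwinnertonDyer.BirchSwinnertonDyer.Theorems.GenusKolyvaginAtTwoEquivariantChebotarevAtTwoQ5Shape
import Summits.BirchSwinnertonDyer.BirchSwinnertonDyer.Theorems.CMKolyvaginAtInertTwoTranspositionAtTwo

/-!
# Route `GenusKolyvaginAtTwo`, LINE 6, Q5 `EquivariantChebotarevAtTwo` WITH THE PARENT'S BINDER
# `¬ IsSquare (d_K · (−|Δ|))` — PROVED UNCONDITIONALLY (seat gk2-p2 g6)

Item stmt-BirchSwinnertonDyer-24881 (Q5 of the split of crux 22137 `KolyvaginExactAtTwo`) asks for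
McCallum 1991 Cor. 3.2 at `p = 2` on `Δ(E) < 0` for `τ`-stable independent families, for EVERY
imaginary quadratic `K`. The parent crux carries Kolyvagin's exclusion
`¬ IsSquare ((d_K : ℚ) · (−|Δ_E|))`, which on `Δ_E < 0` reads `K ≠ ℚ(√Δ_E)`; Q5 dropped it. This
file proves Q5's statement with that ONE binder re-inserted after `IsImaginaryQuadratic K`
(`equivariantChebotarevAtTwo_of_not_isSquare`), with NO other hypothesis: the seat's g5 theorem
`equivariantChebotarevAtTwo_of_chebotarev_of_image` (Q5 modulo Čebotarev and the `Γ_K`-image of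
`E[2]`) is fed
* the tree's PROVED Čebotarev density theorem `Automorphic.chebotarev_artinRep_of_galoisSide`;
* `hS`: `E(K̄)[2]` is a simple `Γ_K`-module — from `ρ̄_{E,2}` onto over `ℚ` and `[K:ℚ] = 2`
  (cell `bsd-print-cf2`, `KolyvaginImageTwo.eq_bot_or_eq_top_two_of_hasSurjectiveModNGaloisRep`);
* `hCe`: scalar commutant — from a TRANSPOSITION in `ρ̄_{E,2}(Γ_K)`
  (`KolyvaginImageTwo.eq_zero_or_eq_id_of_commute_two_of_hasSurjectiveModNGaloisRep`), which exists
  iff `Δ_E ∉ K^{×2}` (`KolyvaginImageTwo.exists_transposition_of_not_isSquare_Δ`), i.e. iff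
  `Δ_E ∉ ℚ^{×2}` (automatic: `ρ̄_{E,2}` onto, Dokchitser–Dokchitser (1)) and `d_K·Δ_E ∉ ℚ^{×2}` —
  THE RE-INSERTED BINDER (`image_two_of_not_isSquare`).

WHY THE BINDER IS NEEDED (evidence `REFUTATION-Q5-discfield.md` on the item): for `K = ℚ(√Δ_E)`
the image `ρ̄_{E,2}(Γ_K)` is `A₃`, `End_{Γ_K} E[2] = 𝔽₄ ∋ ω`, `H¹(K, E[2])` is an `𝔽₄`-space on
which `τ` acts `ω`-semilinearly, and the `τ`-stable, `ℤ`-independent, `𝔽₄`-DEPENDENT family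
`{ωx + ω²x^τ, x, x^τ}` with prescription `N = (1, 0, 0)` has an empty prime set (`loc_v` is
`𝔽₄`-linear) — Q5 as typed is false there; with the binder it is the theorem below.

HONEST FRAMING. Helper for 24881 (`--supports`); it does not close Q5 as typed (whose `K` ranges
over all imaginary quadratic fields). BSD is not proved by any of this.

References: [McCallumLMS1991] §3 Cor. 3.2; [GrossLMS1991] §9 (proof of Prop. 9.3: simplicity and
absolute irreducibility of `E_p` over `Gal(L/K) ≅ GL₂` when `K ⊄ ℚ(E_p)`); [Kolyvagin1989] Thm. B
(the exclusions `K ≠ ℚ(√−|Δ|), ℚ(√−2|Δ|)`); [DokchitserDokchitserMathZ2012] Thm. (1);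
[TateGCFT1967] §2.4.
-/

set_option autoImplicit false
set_option linter.dupNamespace false

noncomputable section

open scoped Classical

namespace Summit.BirchSwinnertonDyer.BirchSwinnertonDyer.Theorems.GenusExact

open WeierstrassCurve NumberField IsDedekindDomain Field
open Literature.NumberTheory.GaloisRepresentations Literature.NumberTheory.EllipticCurves
open Literature.NumberTheory
open Summit.BirchSwinnertonDyer.BirchSwinnertonDyer.Theorems.KolyvaginImageTwo

/-- **`Δ_E ∉ K^{×2}` for `K` quadratic with `d_K · Δ_E ∉ ℚ^{×2}` and `ρ̄_{E,2}` onto** (a rational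
square in `K` lies in `ℚ^{×2} ∪ d_K ℚ^{×2}`; `Δ_E ∉ ℚ^{×2}` by surjectivity mod `2`).
[cite: DokchitserDokchitserMathZ2012, Thm. (1)] -/
theorem not_isSquare_baseChange_Δ_of_not_isSquare (W : WeierstrassCurve ℚ) [W.IsElliptic]
    (K : Type) [Field K] [NumberField K] (hK2 : Module.finrank ℚ K = 2)
    (hsurj : W.HasSurjectiveModNGaloisRep 2)
    (hns : ¬ IsSquare ((NumberField.discr K : ℚ) * W.Δ)) : ¬ IsSquare (W.baseChange K).Δ := by
  have hΔ : (W.baseChange K).Δ = algebraMap ℚ K W.Δ := by rw [baseChange, map_Δ]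
  rw [hΔ]
  intro hsq
  rcases isSquare_or_isSquare_mul_of_isSquare_algebraMap K hK2 hsq with h | h
  · exact DokchitserDokchitser2012.not_isSquare_Δ_of_hasSurjectiveModNGaloisRep_two W two_ne_zero
      hsurj h
  · exact hns h

/-- **The `Γ_K`-module `E(K̄)[2]` for `K` quadratic with `d_K · Δ_E ∉ ℚ^{×2}` and `ρ̄_{E,2}` onto:
SIMPLE with SCALAR commutant** (`ρ̄_{E,2}(Γ_K) = S₃`: the order-`3` element and a transposition).
These are the two image inputs `hS`, `hCe` of `equivariantChebotarevAtTwo_of_chebotarev_of_image`.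
[cite: GrossLMS1991, §9 (proof of Prop. 9.3)] -/
theorem image_two_of_not_isSquare (W : WeierstrassCurve ℚ) [W.IsElliptic]
    (K : Type) [Field K] [NumberField K] (hK2 : Module.finrank ℚ K = 2)
    (hsurj : W.HasSurjectiveModNGaloisRep 2)
    (hns : ¬ IsSquare ((NumberField.discr K : ℚ) * W.Δ)) :
    (∀ H : AddSubgroup (geomTorsion (W.baseChange K) 2),
      (∀ g : absoluteGaloisGroup K, ∀ t ∈ H, g • t ∈ H) → H = ⊥ ∨ H = ⊤) ∧
    (∀ f : geomTorsion (W.baseChange K) 2 →+ geomTorsion (W.baseChange K) 2,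
      (∀ (g : absoluteGaloisGroup K) (t : geomTorsion (W.baseChange K) 2), f (g • t) = g • f t) →
        ∃ k : ℤ, ∀ t, f t = k • t) := by
  haveI : (W.baseChange K).IsElliptic := by rw [baseChange]; infer_instance
  refine ⟨fun H hH ↦ eq_bot_or_eq_top_two_of_hasSurjectiveModNGaloisRep W K hK2 hsurj H hH, ?_⟩
  intro f hf
  obtain ⟨g, u, w, hu0, hu, hw⟩ := exists_transposition_of_not_isSquare_Δ (W.baseChange K)
    (not_isSquare_baseChange_Δ_of_not_isSquare W K hK2 hsurj hns)
  rcases eq_zero_or_eq_id_of_commute_two_of_hasSurjectiveModNGaloisRep W K hK2 hsurj hu hu0 hw f hf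
    with h | h
  · exact ⟨0, fun t ↦ by rw [h t, zero_zsmul]⟩
  · exact ⟨1, fun t ↦ by rw [h t, one_zsmul]⟩

set_option maxHeartbeats 800000 in
/-- **Q5 `EquivariantChebotarevAtTwo` with the parent's binder `¬ IsSquare (d_K · (−|Δ_E|))`,
UNCONDITIONALLY** (McCallum 1991 Cor. 3.2 at `p = 2` for `τ`-stable families). The binders are those
of the route decl `Theses.GenusKolyvaginAtTwo.EquivariantChebotarevAtTwo` verbatim, with the ONE
extra hypothesis `hns` inserted after `IsImaginaryQuadratic K` (on `Δ < 0` it says `K ≠ ℚ(√Δ_E)`;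
it is the binder `¬ IsSquare ((NumberField.discr K : ℚ) * -|W.Δ|)` of the parent crux
`KolyvaginExactAtTwo`). Conclusion: for every prescription `N_i ≤ M_i` constant on `τ`-orbits there
are infinitely many Kolyvagin primes `ℓ` at `2` (Zhang's form, `M ≤ M(ℓ)`, `Frob ℓ = Frob ∞` on
`K(E[2^M])`) at whose place `λ` every `c_i` has local order exactly `2^{N_i}`.
[cite: McCallumLMS1991, §3 Cor. 3.2] [cite: GrossLMS1991, §9] [cite: WZhang2014, Notations (xii)]
[cite: TateGCFT1967, §2.4] -/
theorem equivariantChebotarevAtTwo_of_not_isSquare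
    (N : ℕ) [NeZero N] (W : WeierstrassCurve ℚ) [W.IsElliptic] [W.IsGloballyMinimal]
    (hcm : ¬ W.HasCM) (hΔ : W.Δ < 0) (K : Type) [Field K] [NumberField K]
    (hK : IsImaginaryQuadratic K) (hns : ¬ IsSquare ((NumberField.discr K : ℚ) * -|W.Δ|))
    (hρ : ∀ n : ℕ, W.HasSurjectiveModNGaloisRep (2 ^ n : ℕ)) (c : K ≃ₐ[ℚ] K) (hc : c ≠ 1)
    (M : ℕ) (hM : 1 ≤ M) (r : ℕ) (cs : Fin r → galH1Torsion (W.baseChange K) ((2 ^ M : ℕ) : ℤ))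
    (π : Fin r → Fin r) (h0 : ∀ i, cs i ≠ 0)
    (hτs : ∀ i, conjAct W c ((2 ^ M : ℕ) : ℤ) (cs i) = cs (π i))
    (hind : ∀ a : Fin r → ℤ, ∑ i, a i • cs i = 0 → ∀ i, (addOrderOf (cs i) : ℤ) ∣ a i)
    (hres : ∀ a : Fin r → ℤ, (∀ ρ ∈ torsionFixing (W.baseChange K) ((2 ^ M : ℕ) : ℤ),
      h1Eval (W.baseChange K) ((2 ^ M : ℕ) : ℤ) (∑ i, a i • cs i) ρ = 0) → ∑ i, a i • cs i = 0)
    (Mi : Fin r → ℕ) (hMi : ∀ i, addOrderOf (cs i) = 2 ^ Mi i) (Nv : Fin r → ℕ)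
    (hNe : ∀ i, Nv i ≤ Mi i) (hNπ : ∀ i, Nv (π i) = Nv i) :
    Set.Infinite {ℓ : ℕ | FrobEqFrobInfty W K (2 ^ M) ℓ ∧ Zhang2014.IsKolyvaginPrime N W K 2 ℓ ∧
      M ≤ Zhang2014.kolyvaginIndex W 2 ℓ ∧
      ∀ i, ∀ v : HeightOneSpectrum (𝓞 K), (ℓ : 𝓞 K) ∈ v.asIdeal → ∀ j : ℕ,
        ((2 ^ j : ℕ) : ℤ) • cs i ∈
            (W.baseChange K).torsionLocalKer (v.adicCompletion K) ((2 ^ M : ℕ) : ℤ) ↔ Nv i ≤ j} := by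
  have hsurj : W.HasSurjectiveModNGaloisRep 2 := by simpa using hρ 1
  have habs : -|W.Δ| = W.Δ := by rw [abs_of_neg hΔ, neg_neg]
  rw [habs] at hns
  obtain ⟨hS, hCe⟩ := image_two_of_not_isSquare W K hK.1 hsurj hns
  exact equivariantChebotarevAtTwo_of_chebotarev_of_image Automorphic.chebotarev_artinRep_of_galoisSide
    N W hcm hΔ K hK hS hCe hρ c hc M hM r cs π h0 hτs hind hres Mi hMi Nv hNe hNπ

end Summit.BirchSwinnertonDyer.BirchSwinnertonDyer.Theorems.GenusExact

end
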